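import Summits.HodgeConjecture.HodgeConjecture.Theorems.F0P3cStCharTSParField   -- ★ p851306 (this seat): `exists_parField`, `smoothTrace_eq_of_isConstituentOf_irreducible`; brings ★ `isSmooth_cmPrincipalSeries`, ★ `MonoidHom.continuous_of_continuous_val`
import Summits.HodgeConjecture.HodgeConjecture.Theorems.F0P3cStCharTSOrbit      -- ★ (this seat): `isConstituentOf_iff_of_common_constituent` («ORBIT★»: a common constituent forces equal constituent sets)
import HarnessLib

/-!
# F0 · P3c · line LH6 «StCharTS» — brick «PAR-FIELD-W★» (datum road, S7, MAP-DATUM-ROAD v4 §2.5 ASK (i)): THE PARAMETER MAP `par`, `W`-NORMALISED —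
# (NONL2-PAR) + the (PS1) clause of ★ PAR-FIELD, AND «`par` is CONSTANT on the non-square-integrable constituents of every principal series»

Cell `hodgecm-mathlib`, crux `H413` (`stmt-HodgeConjecture-24833`), line LH6 `Cruxes/H413/Lines/F0_P3c_StCharTSPaydown.lean` (organ (S-𝔇) `stub_EllipticPackage`; the junction
★ p851346 `Theorems/F0P3cStCharTSDatumJunction.lean` reads ONE `par` in (PS1), (NONL2-PAR), (PS2), (PS3) «`par π″ = par π′` for l.d.s. mates» and (UNIQ-PAR), so the
∃-witness must be chosen on `W`-ORBITS — MAP NOTE «W-NORMALISED `par`» (LH6-p01 (g4), 11:58:16Z)).  Seat LH6-p03 (g4); THEOREMS ONLY (no `def`, no named fact, no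
`instance`, no notation, no `sorry`; axioms ⊆ {propext, Classical.choice, Quot.sound}); `--supports stmt-HodgeConjecture-24833`.  HONEST LABEL: HC_CM is proved only modulo
the 7 printed citations (2 remaining: hLiu418 = stmt-HodgeConjecture-24832, h413 = stmt-HodgeConjecture-24833) until rung 0 closes; count-neutral.

THE MATHEMATICS ([Rogawski1990, §12.1 pp. 171–172 (Jacquet's subrepresentation theorem: a non-square-integrable class is a constituent of some `i_G(χ)`), §12.2 p. 173
(«`i_G(χ)` and `i_G(wχ)` have the same constituents»; the inducing datum of a class is a `W`-orbit)]; [BernsteinZelevinsky1977, Thm. 2.9]; [Casselman1995, Cor. 6.3.9]).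
★ PAR-FIELD (`exists_parField`) chose a pair `par₀ π` PER CLASS; two non-square-integrable constituents `π, π′` of one `i_G(χ)` could receive `par₀ π = χ`, `par₀ π′ = wχ`.
Here the choice is made PER CONSTITUENT SET: `par π := θ(S(π))`, where `S(π) = JH-set of i_G(par₀ π)` (a predicate on classes) and `θ` is ONE choice function on predicates,
preferring a continuous pair whose principal series is IRREDUCIBLE with exactly that constituent set, else a continuous pair with that constituent set, else anything.  By
«ORBIT★» (★ `isConstituentOf_iff_of_common_constituent`: two principal series with a common constituent have the same constituents) `S(π) = JH(i_G(χ)) = S(π′)` whenever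
`π, π′` are non-square-integrable constituents of `i_G(χ)` (`χ` continuous), so `par π = par π′` — the `W`-clause; (NONL2-PAR) because `π ∈ S(π) = JH(i_G(par π))`; the (PS1)
clause because on a class of an irreducible principal series the preferred branch of `θ` fires (witness `par₀ π`, ★ PAR-FIELD (b)), so `i_G(par π)` is irreducible with
`π` its constituent and `Θ_π = Θ_{i_G(par π)}` (★ `smoothTrace_eq_of_isConstituentOf_irreducible`).

* §1 THE HEAD `exists_parField_W` — clauses (a) = (NONL2-PAR) and (b) ⊇ (PS1) of ★ `exists_parField` TOKEN FOR TOKEN, plus (c) the `W`-clause.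

## References
* [Rogawski1990] J. D. Rogawski, *Automorphic Representations of Unitary Groups in Three Variables*, Ann. of Math. Stud. 123 (1990): §12.1 pp. 171–172, §12.2 p. 173.
* [BernsteinZelevinsky1977] I. N. Bernstein, A. V. Zelevinsky, *Induced representations of reductive p-adic groups I*, Ann. Sci. ÉNS 10 (1977): Thm. 2.9.
* [Casselman1995] W. Casselman, *Introduction to the theory of admissible representations of p-adic reductive groups* (1974∕1995): Thm. 5.3.1, Cor. 6.3.9 (b) p. 60.
-/

set_option autoImplicit false
-- the mandated namespace has the single-problem summit's repeated segment (`HodgeConjecture.HodgeConjecture`)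
set_option linter.dupNamespace false

noncomputable section

open NumberField IsDedekindDomain MeasureTheory
open scoped Matrix

open Literature.NumberTheory Literature.NumberTheory.Automorphic Literature.NumberTheory.Automorphic.UnitaryGroup
open Literature.NumberTheory.Rogawski1990

namespace Summit.HodgeConjecture.HodgeConjecture.Cruxes.H413.F0P3cStCharTSParFieldW

variable (L : Type) [Field L] [NumberField L] [IsCMField L]

/-! ## §1 THE HEAD — `par`, `W`-normalised -/

set_option synthInstance.maxHeartbeats 400000 in
set_option maxHeartbeats 8000000 in
-- statement-heavy: every `π.IsConstituentOf (cmPrincipalSeries …)` ∕ `smoothTrace (G := Gqs L v) (cmPrincipalSeries …)` token re-checks the `Gqs`↔carrier defeq (same class as ★ PAR-FIELD's 4000000; three clauses here)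
/-- **«PAR-FIELD-W★» — THE PARAMETER MAP OF THE NON-SQUARE-INTEGRABLE CLASSES, `W`-NORMALISED.**  At a NON-SPLIT finite place `v` and for a Haar measure `μZ` on
`U(Φ₃)(L⁺_v) ⧸ Z`: there is `par : E(U(Φ₃)(L⁺_v)) → (L_vˣ →* ℂˣ) × (E¹_v →* ℂˣ)` with (a) = (NONL2-PAR) and (b) ⊇ (PS1) EXACTLY as in ★ `exists_parField` (same tokens), AND
(c) the `W`-clause: for every continuous pair `(χ₁, χ₂)` and all classes `π, π′` NOT square-integrable modulo the centre which are BOTH constituents of `i_G(χ₁, χ₂)`,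
`par π = par π′` — `par` is a function of the constituent SET `JH(i_G(χ)) = JH(i_G(wχ))`, i.e. of the `W`-orbit `{χ, wχ}` (★ ORBIT).  Construction: one choice function on
constituent-set predicates (irreducible continuous witness preferred), evaluated at `JH(i_G(par₀ π))` for ★ PAR-FIELD's `par₀`.
[cite: Rogawski1990, §12.1 pp. 171–172; §12.2 pp. 173–174] [cite: BernsteinZelevinsky1977, Thm. 2.9] [cite: Casselman1995, Thm. 5.3.1; Cor. 6.3.9 (b)] -/
theorem exists_parField_W (v : HeightOneSpectrum (𝓞 ↥(maximalRealSubfield L))) (hns : ∀ w : PlacesOver L v, IsCMField.complexConj L • w.1 = w.1)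
    [MeasurableSpace (Gqs L v)]
    [MeasurableSpace (Gqs L v ⧸ Subgroup.center (Gqs L v))] (μZ : Measure (Gqs L v ⧸ Subgroup.center (Gqs L v))) [μZ.IsHaarMeasure] :
    ∃ par : IrrClass (Gqs L v) → ((UnitaryGroup.LocalRing L v)ˣ →* ℂˣ) × (↥(normOneUnits (conjLocal L (IsCMField.complexConj L) v)) →* ℂˣ),
      (∀ π : IrrClass (Gqs L v), ¬ π.IsSquareIntegrable μZ →
          π.IsConstituentOf (UnitaryGroup.cmPrincipalSeries L 3 v (UnitaryGroup.cmTorusCharPair L v (par π).1 (par π).2)) ∧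
            Continuous (par π).1 ∧ Continuous (par π).2) ∧
      (∀ π : IrrClass (Gqs L v),
        (∃ (χ₁ : (UnitaryGroup.LocalRing L v)ˣ →* ℂˣ) (χ₂ : ↥(normOneUnits (conjLocal L (IsCMField.complexConj L) v)) →* ℂˣ),
            Continuous (fun x => ((χ₁ x : ℂˣ) : ℂ)) ∧ Continuous (fun x => ((χ₂ x : ℂˣ) : ℂ)) ∧
            (UnitaryGroup.cmPrincipalSeries L 3 v (UnitaryGroup.cmTorusCharPair L v χ₁ χ₂)).IsIrreducible ∧
            π.IsConstituentOf (UnitaryGroup.cmPrincipalSeries L 3 v (UnitaryGroup.cmTorusCharPair L v χ₁ χ₂))) →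
        (UnitaryGroup.cmPrincipalSeries L 3 v (UnitaryGroup.cmTorusCharPair L v (par π).1 (par π).2)).IsIrreducible ∧
          π.IsConstituentOf (UnitaryGroup.cmPrincipalSeries L 3 v (UnitaryGroup.cmTorusCharPair L v (par π).1 (par π).2)) ∧
          Continuous (par π).1 ∧ Continuous (par π).2 ∧
          Continuous (fun x => (((par π).1 x : ℂˣ) : ℂ)) ∧ Continuous (fun x => (((par π).2 x : ℂˣ) : ℂ)) ∧
          ∀ (ν : Measure (Gqs L v)) (f : Gqs L v → ℂ),
            π.smoothTrace ν f =
              Representation.smoothTrace (G := Gqs L v) (UnitaryGroup.cmPrincipalSeries L 3 v (UnitaryGroup.cmTorusCharPair L v (par π).1 (par π).2)) ν f) ∧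
      ∀ (χ₁ : (UnitaryGroup.LocalRing L v)ˣ →* ℂˣ) (χ₂ : ↥(normOneUnits (conjLocal L (IsCMField.complexConj L) v)) →* ℂˣ),
        Continuous (fun x => ((χ₁ x : ℂˣ) : ℂ)) → Continuous (fun x => ((χ₂ x : ℂˣ) : ℂ)) →
        ∀ π π' : IrrClass (Gqs L v), ¬ π.IsSquareIntegrable μZ → ¬ π'.IsSquareIntegrable μZ →
          π.IsConstituentOf (UnitaryGroup.cmPrincipalSeries L 3 v (UnitaryGroup.cmTorusCharPair L v χ₁ χ₂)) →
          π'.IsConstituentOf (UnitaryGroup.cmPrincipalSeries L 3 v (UnitaryGroup.cmTorusCharPair L v χ₁ χ₂)) →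
          par π = par π' := by
  classical
  -- ★ PAR-FIELD's per-class choice `par₀`
  obtain ⟨par₀, hA, hB⟩ := F0P3cStCharTSParField.exists_parField L v hns μZ
  -- ONE choice function `θ` on constituent-set PREDICATES `A` (so that classes with the same constituent set receive the same pair), preferring an irreducible
  -- continuous witness, else a continuous witness, else the trivial pair (never read)
  have hset : ∀ A : IrrClass (Gqs L v) → Prop,
      ∃ θ : ((UnitaryGroup.LocalRing L v)ˣ →* ℂˣ) × (↥(normOneUnits (conjLocal L (IsCMField.complexConj L) v)) →* ℂˣ),
        ((∃ χ : ((UnitaryGroup.LocalRing L v)ˣ →* ℂˣ) × (↥(normOneUnits (conjLocal L (IsCMField.complexConj L) v)) →* ℂˣ),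
            Continuous (fun x => ((χ.1 x : ℂˣ) : ℂ)) ∧ Continuous (fun x => ((χ.2 x : ℂˣ) : ℂ)) ∧
            (UnitaryGroup.cmPrincipalSeries L 3 v (UnitaryGroup.cmTorusCharPair L v χ.1 χ.2)).IsIrreducible ∧
            ∀ d : IrrClass (Gqs L v), A d ↔ d.IsConstituentOf (UnitaryGroup.cmPrincipalSeries L 3 v (UnitaryGroup.cmTorusCharPair L v χ.1 χ.2))) →
          Continuous (fun x => ((θ.1 x : ℂˣ) : ℂ)) ∧ Continuous (fun x => ((θ.2 x : ℂˣ) : ℂ)) ∧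
            (UnitaryGroup.cmPrincipalSeries L 3 v (UnitaryGroup.cmTorusCharPair L v θ.1 θ.2)).IsIrreducible ∧
            ∀ d : IrrClass (Gqs L v), A d ↔ d.IsConstituentOf (UnitaryGroup.cmPrincipalSeries L 3 v (UnitaryGroup.cmTorusCharPair L v θ.1 θ.2))) ∧
        ((∃ χ : ((UnitaryGroup.LocalRing L v)ˣ →* ℂˣ) × (↥(normOneUnits (conjLocal L (IsCMField.complexConj L) v)) →* ℂˣ),
            Continuous (fun x => ((χ.1 x : ℂˣ) : ℂ)) ∧ Continuous (fun x => ((χ.2 x : ℂˣ) : ℂ)) ∧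
            ∀ d : IrrClass (Gqs L v), A d ↔ d.IsConstituentOf (UnitaryGroup.cmPrincipalSeries L 3 v (UnitaryGroup.cmTorusCharPair L v χ.1 χ.2))) →
          Continuous (fun x => ((θ.1 x : ℂˣ) : ℂ)) ∧ Continuous (fun x => ((θ.2 x : ℂˣ) : ℂ)) ∧
            ∀ d : IrrClass (Gqs L v), A d ↔ d.IsConstituentOf (UnitaryGroup.cmPrincipalSeries L 3 v (UnitaryGroup.cmTorusCharPair L v θ.1 θ.2))) := by
    intro A
    by_cases h1 : ∃ χ : ((UnitaryGroup.LocalRing L v)ˣ →* ℂˣ) × (↥(normOneUnits (conjLocal L (IsCMField.complexConj L) v)) →* ℂˣ),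
        Continuous (fun x => ((χ.1 x : ℂˣ) : ℂ)) ∧ Continuous (fun x => ((χ.2 x : ℂˣ) : ℂ)) ∧
        (UnitaryGroup.cmPrincipalSeries L 3 v (UnitaryGroup.cmTorusCharPair L v χ.1 χ.2)).IsIrreducible ∧
        ∀ d : IrrClass (Gqs L v), A d ↔ d.IsConstituentOf (UnitaryGroup.cmPrincipalSeries L 3 v (UnitaryGroup.cmTorusCharPair L v χ.1 χ.2))
    · obtain ⟨χ, hc1, hc2, hirr, hAχ⟩ := h1
      exact ⟨χ, fun _ => ⟨hc1, hc2, hirr, hAχ⟩, fun _ => ⟨hc1, hc2, hAχ⟩⟩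
    · by_cases h2 : ∃ χ : ((UnitaryGroup.LocalRing L v)ˣ →* ℂˣ) × (↥(normOneUnits (conjLocal L (IsCMField.complexConj L) v)) →* ℂˣ),
          Continuous (fun x => ((χ.1 x : ℂˣ) : ℂ)) ∧ Continuous (fun x => ((χ.2 x : ℂˣ) : ℂ)) ∧
          ∀ d : IrrClass (Gqs L v), A d ↔ d.IsConstituentOf (UnitaryGroup.cmPrincipalSeries L 3 v (UnitaryGroup.cmTorusCharPair L v χ.1 χ.2))
      · obtain ⟨χ, hc1, hc2, hAχ⟩ := h2
        exact ⟨χ, fun h => absurd h h1, fun _ => ⟨hc1, hc2, hAχ⟩⟩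
      · exact ⟨1, fun h => absurd h h1, fun h => absurd h h2⟩
  choose θ hθ using hset
  -- `par π := θ (JH-set of i_G(par₀ π))`
  refine ⟨fun π => θ (fun d : IrrClass (Gqs L v) =>
      d.IsConstituentOf (UnitaryGroup.cmPrincipalSeries L 3 v (UnitaryGroup.cmTorusCharPair L v (par₀ π).1 (par₀ π).2))),
    fun π hπ => ?_, fun π hIπ => ?_, fun χ₁ χ₂ hc1 hc2 π π' hπ hπ' hc hc' => ?_⟩
  · -- (a) = (NONL2-PAR): the plain branch of `θ` fires with witness `par₀ π`, and `π ∈ JH(i_G(par₀ π))`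
    obtain ⟨hcπ, h1, h2⟩ := hA π hπ
    obtain ⟨hθ1, hθ2, hθA⟩ := (hθ _).2 ⟨par₀ π, Units.continuous_val.comp h1, Units.continuous_val.comp h2, fun _ => Iff.rfl⟩
    exact ⟨(hθA π).1 hcπ, MonoidHom.continuous_of_continuous_val _ hθ1, MonoidHom.continuous_of_continuous_val _ hθ2⟩
  · -- (b) ⊇ (PS1): the preferred branch of `θ` fires with witness `par₀ π` (★ PAR-FIELD (b): `i_G(par₀ π)` irreducible, `π` its constituent)
    obtain ⟨hirr, hcπ, -, -, h1, h2, -⟩ := hB π hIπ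
    obtain ⟨hθ1, hθ2, hθirr, hθA⟩ := (hθ _).1 ⟨par₀ π, h1, h2, hirr, fun _ => Iff.rfl⟩
    have hcθ := (hθA π).1 hcπ
    -- smoothness of `i_G(par π)` read in the `Gqs L v` currency
    have hsm : Representation.IsSmooth (G := Gqs L v)
        (UnitaryGroup.cmPrincipalSeries L 3 v (UnitaryGroup.cmTorusCharPair L v
          (θ (fun d : IrrClass (Gqs L v) =>
            d.IsConstituentOf (UnitaryGroup.cmPrincipalSeries L 3 v (UnitaryGroup.cmTorusCharPair L v (par₀ π).1 (par₀ π).2)))).1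
          (θ (fun d : IrrClass (Gqs L v) =>
            d.IsConstituentOf (UnitaryGroup.cmPrincipalSeries L 3 v (UnitaryGroup.cmTorusCharPair L v (par₀ π).1 (par₀ π).2)))).2)) :=
      F0P2pCmPrincipalSeriesInterface.isSmooth_cmPrincipalSeries L v _
    exact ⟨hθirr, hcθ, MonoidHom.continuous_of_continuous_val _ hθ1, MonoidHom.continuous_of_continuous_val _ hθ2, hθ1, hθ2, fun ν f =>
      F0P3cStCharTSParField.smoothTrace_eq_of_isConstituentOf_irreducible π ν f hcθ hθirr hsm⟩
  · -- (c) the `W`-clause: `JH(i_G(par₀ π)) = JH(i_G(χ)) = JH(i_G(par₀ π′))` by ★ ORBIT (common constituents `π`, `π′`), so `θ` receives the same predicate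
    obtain ⟨hcπ, h1, h2⟩ := hA π hπ
    obtain ⟨hcπ', h1', h2'⟩ := hA π' hπ'
    have hS : (fun d : IrrClass (Gqs L v) =>
          d.IsConstituentOf (UnitaryGroup.cmPrincipalSeries L 3 v (UnitaryGroup.cmTorusCharPair L v (par₀ π).1 (par₀ π).2))) =
        (fun d : IrrClass (Gqs L v) =>
          d.IsConstituentOf (UnitaryGroup.cmPrincipalSeries L 3 v (UnitaryGroup.cmTorusCharPair L v (par₀ π').1 (par₀ π').2))) := by
      funext d
      exact propext
        ((F0P3cStCharTSOrbit.isConstituentOf_iff_of_common_constituent L v hns χ₁ χ₂ hc1 hc2 (par₀ π).1 (par₀ π).2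
            (Units.continuous_val.comp h1) (Units.continuous_val.comp h2) π hc hcπ d).trans
          (F0P3cStCharTSOrbit.isConstituentOf_iff_of_common_constituent L v hns χ₁ χ₂ hc1 hc2 (par₀ π').1 (par₀ π').2
            (Units.continuous_val.comp h1') (Units.continuous_val.comp h2') π' hc' hcπ' d).symm)
    exact congrArg θ hS

end Summit.HodgeConjecture.HodgeConjecture.Cruxes.H413.F0P3cStCharTSParFieldW

end
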